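import Summits.CriticalPhenomena.PercolationContinuityZ3.Theorems.FK.InfiniteVolumeDLRClusters
import Summits.CriticalPhenomena.PercolationContinuityZ3.Theorems.FK.InfiniteVolumeOneEdgeDLRClosed
import Literature.Probability.Percolation.BoundaryDecay
import HarnessLib

/-!
# FK-continuity transplant, FO-06 (construction half): Grimmett's Lemma (4.39) for a region — off the
# local bad event `D_m(Λ)` the induced boundary condition is read inside the box `Λ_m`; `P(D_m(Λ)) → 0`

Cell `fk-continuity` (bschramm), row FO-06b-6; support file for the FK-continuity transplant
(`--supports stmt-CriticalPhenomena-4575`); builds on p205010 (kernel theorem, internal audit signed;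
external expert review pending). No named facts, no sorries, standard axioms. General dimension `d`.

Grimmett 2006, Lemma (4.39) and its proof (p. 83): the boundary condition that a configuration `ξ`
induces on a region `Λ` (which vertices of `Λ` are joined OFF `E_Λ`) is discontinuous in `ξ` only on
`{I_Λ ≥ 2}` (two infinite clusters off `E_Λ` touching `Λ`); on the complement of the LOCAL event
`D_m(Λ) = regionBadEvent Λ m` ("off `E_Λ`, two vertices of `Λ` exit `Λ_m` without being joined inside
`Λ_m`") the induced partition is already determined by the configuration inside `Λ_m` — for the infinite
configuration AND for every finite-box configuration with an arbitrary wired set outside `Λ_m`.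

* `exists_exit_of_reachable_sup_wired_of_not_mem_openConnVia` — one-sided exit (boundary-dart argument,
  the region version of 06b-g2's `exists_exit_of_reachable_sup_wired`);
* `mem_openConnVia_of_reachable_sup_wired` / `reachable_sup_wired_iff_mem_openConnVia` — off `D_m(Λ)`,
  joined through anything (far edges, a wired set `W` outside `Λ_m`) iff joined inside `Λ_m`;
* `reachable_union_sdiff_iff_inter_sym2`, `rcCondProb_eq_inter_sym2_of_not_mem_regionBadEvent` — hence the
  specification kernel `φ^ξ_{Λ,p,q}` at a good `ξ` equals the kernel at `ξ ∩ (Λ_m × Λ_m)`, a LOCAL function;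
* `reachable_sup_wired_liftEdges_iff` — transport of wired reachability through `liftEdges`.

That `P(D_m(Λ)) → 0` is the companion `InfiniteVolumeDLRBadEvent.lean`.

## References

* G. Grimmett, *The Random-Cluster Model*, Springer 2006: Lemma (4.39) eqs. (4.40)–(4.42), proof of
  Thm. (4.31) pp. 83–86. [Grimmett2006]
-/

noncomputable section

open MeasureTheory Set Filter
open scoped Topology ENNReal

namespace Summit.CriticalPhenomena.PercolationContinuityZ3.Theorems.FK

open Literature.Probability.Percolation Literature.Probability.LatticeModels

variable {d : ℕ}

/-! ### Deterministic: off `D_m(Λ)`, far connections between vertices of `Λ` are local -/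

section Deterministic

/-- Edges of `E_Λ` have both endpoints in `Λ`. [cite: Grimmett2006, §4.2 (E_Λ)] -/
theorem mem_of_mem_edgesIn {Λ : Finset (Site d)} {e : Sym2 (Site d)} (he : e ∈ (↑(edgesIn (zdGraph d) Λ) : Set _))
    {x : Site d} (hx : x ∈ e) : x ∈ Λ :=
  ((mem_edgesIn_iff.1 (Finset.mem_coe.1 he)).2 x hx)

/-- `openConnVia K` is transitive. [folklore] -/
theorem mem_openConnVia_trans {V : Type*} {K : SimpleGraph V} {ω : BondConfig V} {x y z : V}
    (hxy : ω ∈ openConnVia K x y) (hyz : ω ∈ openConnVia K y z) : ω ∈ openConnVia K x z := by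
  change z ∈ openClusterIn K ω x
  change y ∈ openClusterIn K ω x at hxy
  change z ∈ openClusterIn K ω y at hyz
  rw [mem_openClusterIn_iff] at hxy hyz ⊢
  exact hxy.trans hyz

/-- **One-sided exit** (the boundary-dart step of Grimmett's Lemma (4.39), region version): let `W` be a
wired set outside `Λ_m`, `ζ` a lattice configuration, `η ⊆ E_Λ` an inside pattern, `Λ ⊆ Λ_m`. If `u ∈ Λ` is
joined to `v` through `⟨η ∪ ζ⟩ ∨ K_W` but not inside `Λ_m`, then some vertex `a ∈ Λ`, joined to `u` inside
`Λ_m`, exits `Λ_m` along `ζ`. [cite: Grimmett2006, Lemma (4.39) (proof, p. 83)] -/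
theorem exists_exit_of_reachable_sup_wired_of_not_mem_openConnVia {Λ : Finset (Site d)} {m : ℕ}
    (hΛm : Λ ⊆ box d m) {W : Set (Site d)} (hW : ∀ c ∈ W, c ∉ box d m) {ζ : BondConfig (Site d)}
    (hζE : ζ ⊆ (zdGraph d).edgeSet) {η : Set (Sym2 (Site d))} (hη : η ⊆ ↑(edgesIn (zdGraph d) Λ))
    {u v : Site d} (hu : u ∈ Λ) (h : (openGraph (η ∪ ζ) ⊔ wired W).Reachable u v)
    (hnot : η ∪ ζ ∉ openConnVia (withinGraph ⊤ (↑(box d m) : Set (Site d))) u v) :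
    ∃ a ∈ Λ, η ∪ ζ ∈ openConnVia (withinGraph ⊤ (↑(box d m) : Set (Site d))) u a ∧ ζ ∈ exitsBox d m a := by
  classical
  set K := withinGraph ⊤ (↑(box d m) : Set (Site d)) with hK
  set κ := η ∪ ζ with hκ
  -- `S` = the vertices reached from `u` inside `Λ_m`, the last stretch (from a vertex of `Λ`) along `ζ` only
  set S : Set (Site d) := {x | ∃ a ∈ Λ, κ ∈ openConnVia K u a ∧ ζ ∈ openConnVia K a x} with hS
  have huS : u ∈ S := ⟨u, hu, self_mem_openClusterIn K κ u, self_mem_openClusterIn K ζ u⟩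
  -- if `v ∈ S` then `u ↔ v` inside `Λ_m`
  have hvS : v ∉ S := by
    rintro ⟨a, -, hua, hav⟩
    exact hnot (mem_openConnVia_trans hua (isUpperSet_openConnVia K a v Set.subset_union_right hav))
  obtain ⟨w⟩ := h
  obtain ⟨e, -, heS, heS'⟩ := w.exists_boundary_dart S huS hvS
  obtain ⟨a₀, ha₀, hua₀, ha₀x⟩ := heS
  set x := e.toProd.1
  set y := e.toProd.2
  -- `x ∈ Λ_m`: the `ζ`-path from `a₀ ∈ Λ ⊆ Λ_m` stays inside `Λ_m`
  have hxm : x ∈ box d m :=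
    Finset.mem_coe.1 (openClusterIn_withinGraph_subset (G := (⊤ : SimpleGraph (Site d)))
      (Finset.mem_coe.2 (hΛm ha₀)) ζ ha₀x)
  rcases (SimpleGraph.sup_adj _ _ _ _).1 e.adj with hopen | hwired
  · rw [openGraph_adj] at hopen
    obtain ⟨hxy, hne⟩ := hopen
    rcases hxy with hxyη | hxyζ
    · -- an edge of `E_Λ`: both endpoints in `Λ`, so `y ∈ S` via `a := y`
      have hyΛ : y ∈ Λ := mem_of_mem_edgesIn (hη hxyη) (Sym2.mem_mk_right x y)
      refine (heS' ⟨y, hyΛ, ?_, self_mem_openClusterIn K ζ y⟩).elim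
      have hux : κ ∈ openConnVia K u x :=
        mem_openConnVia_trans hua₀ (isUpperSet_openConnVia K a₀ x Set.subset_union_right ha₀x)
      exact mem_openClusterIn_of_adj hux
        ⟨(SimpleGraph.top_adj _ _).2 hne, Finset.mem_coe.2 hxm, Finset.mem_coe.2 (hΛm hyΛ)⟩ (Or.inl hxyη)
    · -- an edge of `ζ`: if `y ∈ Λ_m` then `y ∈ S`; otherwise `a₀` exits through it
      by_cases hym : y ∈ box d m
      · exact (heS' ⟨a₀, ha₀, hua₀, mem_openClusterIn_of_adj ha₀x
          ⟨(SimpleGraph.top_adj _ _).2 hne, Finset.mem_coe.2 hxm, Finset.mem_coe.2 hym⟩ hxyζ⟩).elim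
      · have hadj : (zdGraph d).Adj x y := by
          have := hζE hxyζ
          rwa [SimpleGraph.mem_edgeSet] at this
        refine ⟨a₀, ha₀, hua₀, y, mem_box_succ_of_zdGraph_adj d hxm hadj, hym, ?_⟩
        have ha₀x' : x ∈ openClusterIn (withinGraph ⊤ (↑(box d (m + 1)) : Set (Site d))) ζ a₀ :=
          openClusterIn_mono_graph (withinGraph_mono ⊤ (Finset.coe_subset.2 (box_mono d (Nat.le_succ m))))
            ζ _ ha₀x
        exact mem_openClusterIn_of_adj ha₀x' ⟨(SimpleGraph.top_adj _ _).2 hne,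
          Finset.mem_coe.2 (box_mono d (Nat.le_succ m) hxm),
          Finset.mem_coe.2 (mem_box_succ_of_zdGraph_adj d hxm hadj)⟩ hxyζ
  · -- a wired jump starts in `W`, outside `Λ_m`: impossible
    rw [wired_adj] at hwired
    exact (hW x hwired.2.1 hxm).elim

/-- **Off the bad event, far connections are local** (Grimmett 2006, Lemma (4.39) for a region): with `W`
wired outside `Λ_m`, `ζ` a lattice configuration such that any two vertices of `Λ` that both exit `Λ_m`
along `ζ` are joined inside `Λ_m` by `ζ`, and `η ⊆ E_Λ`: two vertices of `Λ ⊆ Λ_m` joined through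
`⟨η ∪ ζ⟩ ∨ K_W` are joined by `η ∪ ζ` inside `Λ_m`. [cite: Grimmett2006, Lemma (4.39)] -/
theorem mem_openConnVia_of_reachable_sup_wired {Λ : Finset (Site d)} {m : ℕ} (hΛm : Λ ⊆ box d m)
    {W : Set (Site d)} (hW : ∀ c ∈ W, c ∉ box d m) {ζ : BondConfig (Site d)} (hζE : ζ ⊆ (zdGraph d).edgeSet)
    (hgood : ∀ a ∈ Λ, ∀ a' ∈ Λ, ζ ∈ exitsBox d m a → ζ ∈ exitsBox d m a' →
      ζ ∈ openConnVia (withinGraph ⊤ (↑(box d m) : Set (Site d))) a a')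
    {η : Set (Sym2 (Site d))} (hη : η ⊆ ↑(edgesIn (zdGraph d) Λ)) {u v : Site d} (hu : u ∈ Λ) (hv : v ∈ Λ)
    (h : (openGraph (η ∪ ζ) ⊔ wired W).Reachable u v) :
    η ∪ ζ ∈ openConnVia (withinGraph ⊤ (↑(box d m) : Set (Site d))) u v := by
  set K := withinGraph ⊤ (↑(box d m) : Set (Site d)) with hK
  by_contra hnot
  obtain ⟨a₀, ha₀, hua₀, hexit₀⟩ :=
    exists_exit_of_reachable_sup_wired_of_not_mem_openConnVia hΛm hW hζE hη hu h hnot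
  have hnot' : η ∪ ζ ∉ openConnVia K v u := fun h' => hnot (by rwa [BoundaryDecay.openConnVia_comm] at h')
  obtain ⟨a₁, ha₁, hva₁, hexit₁⟩ :=
    exists_exit_of_reachable_sup_wired_of_not_mem_openConnVia hΛm hW hζE hη hv h.symm hnot'
  have hmid : η ∪ ζ ∈ openConnVia K a₀ a₁ :=
    isUpperSet_openConnVia K a₀ a₁ Set.subset_union_right (hgood a₀ ha₀ a₁ ha₁ hexit₀ hexit₁)
  have hva₁' : η ∪ ζ ∈ openConnVia K a₁ v := by rwa [BoundaryDecay.openConnVia_comm] at hva₁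
  exact hnot (mem_openConnVia_trans (mem_openConnVia_trans hua₀ hmid) hva₁')

/-- The `iff` form: off the bad event, joined through `⟨η ∪ ζ⟩ ∨ K_W` iff joined by `η ∪ ζ` inside `Λ_m`.
[cite: Grimmett2006, Lemma (4.39)] -/
theorem reachable_sup_wired_iff_mem_openConnVia {Λ : Finset (Site d)} {m : ℕ} (hΛm : Λ ⊆ box d m)
    {W : Set (Site d)} (hW : ∀ c ∈ W, c ∉ box d m) {ζ : BondConfig (Site d)} (hζE : ζ ⊆ (zdGraph d).edgeSet)
    (hgood : ∀ a ∈ Λ, ∀ a' ∈ Λ, ζ ∈ exitsBox d m a → ζ ∈ exitsBox d m a' →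
      ζ ∈ openConnVia (withinGraph ⊤ (↑(box d m) : Set (Site d))) a a')
    {η : Set (Sym2 (Site d))} (hη : η ⊆ ↑(edgesIn (zdGraph d) Λ)) {u v : Site d} (hu : u ∈ Λ) (hv : v ∈ Λ) :
    (openGraph (η ∪ ζ) ⊔ wired W).Reachable u v ↔
      η ∪ ζ ∈ openConnVia (withinGraph ⊤ (↑(box d m) : Set (Site d))) u v := by
  refine ⟨mem_openConnVia_of_reachable_sup_wired hΛm hW hζE hgood hη hu hv, fun h => ?_⟩
  have h' : v ∈ openClusterIn (withinGraph ⊤ (↑(box d m) : Set (Site d))) (η ∪ ζ) u := h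
  rw [mem_openClusterIn_iff] at h'
  exact (h'.mono inf_le_left).mono le_sup_left

/-- The good event, unpacked: off `D_m(Λ)`, two vertices of `Λ` that both exit `Λ_m` off `E_Λ` are joined
inside `Λ_m` off `E_Λ`. [cite: Grimmett2006, Lemma (4.39) eq. (4.40)] -/
theorem forall_openConnVia_of_not_mem_regionBadEvent {Λ : Finset (Site d)} {m : ℕ} {χ : BondConfig (Site d)}
    (hgood : χ ∉ regionBadEvent Λ m) :
    ∀ a ∈ Λ, ∀ a' ∈ Λ, χ \ ↑(edgesIn (zdGraph d) Λ) ∈ exitsBox d m a →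
      χ \ ↑(edgesIn (zdGraph d) Λ) ∈ exitsBox d m a' →
        χ \ ↑(edgesIn (zdGraph d) Λ) ∈ openConnVia (withinGraph ⊤ (↑(box d m) : Set (Site d))) a a' := by
  intro a ha a' ha' h1 h2
  by_contra h3
  exact hgood (mem_regionBadEvent_iff.2 ⟨a, ha, a', ha', h1, h2, h3⟩)

/-- The step graph `withinGraph ⊤ Λ_m` has the non-diagonal pairs of `Λ_m` as edges; reading a
configuration inside `Λ_m` (`∩ Λ_m.sym2`) gives the same open graph as restricting to those edges.
[folklore] -/
theorem openGraph_inter_sym2_eq (m : ℕ) (κ : BondConfig (Site d)) :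
    openGraph (κ ∩ ↑((box d m).sym2)) = openGraph κ ⊓ withinGraph ⊤ (↑(box d m) : Set (Site d)) := by
  ext x y
  simp only [openGraph_adj, SimpleGraph.inf_adj, withinGraph_adj, SimpleGraph.top_adj, Set.mem_inter_iff,
    Finset.mem_coe, Finset.mk_mem_sym2_iff]
  tauto

/-- Inside `Λ_m`, "joined by `η ∪ (χ ∖ E_Λ)` inside `Λ_m`" reads the configuration `χ ∩ Λ_m²`:
`η ∪ (χ ∖ E_Λ) ∈ {u ↔ v in Λ_m}` iff `u ↔ v` in `η ∪ ((χ ∩ Λ_m²) ∖ E_Λ)` (`η ⊆ E_Λ`, `Λ ⊆ Λ_m`). [folklore] -/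
theorem union_sdiff_mem_openConnVia_iff_reachable_inter_sym2 {Λ : Finset (Site d)} {m : ℕ} (hΛm : Λ ⊆ box d m)
    (χ : BondConfig (Site d)) {η : Finset (Sym2 (Site d))} (hη : η ⊆ edgesIn (zdGraph d) Λ) (u v : Site d) :
    (↑η : Set (Sym2 (Site d))) ∪ (χ \ ↑(edgesIn (zdGraph d) Λ)) ∈
        openConnVia (withinGraph ⊤ (↑(box d m) : Set (Site d))) u v ↔
      (openGraph ((↑η : Set (Sym2 (Site d))) ∪ ((χ ∩ ↑((box d m).sym2)) \ ↑(edgesIn (zdGraph d) Λ)))).Reachable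
        u v := by
  set U : Set (Sym2 (Site d)) := ↑(edgesIn (zdGraph d) Λ) with hU
  have hη' : (↑η : Set (Sym2 (Site d))) ⊆ U := Finset.coe_subset.2 hη
  change v ∈ openClusterIn _ _ u ↔ _
  rw [mem_openClusterIn_iff, ← openGraph_inter_sym2_eq]
  have hset : ((↑η : Set (Sym2 (Site d))) ∪ χ \ U) ∩ ↑((box d m).sym2) =
      (↑η : Set (Sym2 (Site d))) ∪ (χ ∩ ↑((box d m).sym2)) \ U := by
    ext e
    simp only [Set.mem_inter_iff, Set.mem_union, Set.mem_sdiff]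
    constructor
    · rintro ⟨he | ⟨heχ, heU⟩, hem⟩
      · exact Or.inl he
      · exact Or.inr ⟨⟨heχ, hem⟩, heU⟩
    · rintro (he | ⟨⟨heχ, hem⟩, heU⟩)
      · refine ⟨Or.inl he, ?_⟩
        have heU : e ∈ U := hη' he
        rw [Finset.mem_coe, Finset.mem_sym2_iff]
        intro x hx
        exact hΛm (mem_of_mem_edgesIn heU hx)
      · exact ⟨Or.inr ⟨heχ, heU⟩, hem⟩
  rw [hset]

/-- **Off `D_m(Λ)` the induced connections are read inside `Λ_m`, through any wiring outside `Λ_m`**: for a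
lattice configuration `χ ∉ D_m(Λ)`, `Λ ⊆ Λ_m`, `W` outside `Λ_m`, every inside pattern `η ⊆ E_Λ` and `u, v ∈ Λ`:
`u ↔ v` through `⟨η ∪ (χ ∖ E_Λ)⟩ ∨ K_W` iff `u ↔ v` in `η ∪ ((χ ∩ Λ_m²) ∖ E_Λ)`. [cite: Grimmett2006, Lemma (4.39)] -/
theorem reachable_sup_wired_union_sdiff_iff_inter_sym2 {Λ : Finset (Site d)} {m : ℕ} (hΛm : Λ ⊆ box d m)
    {W : Set (Site d)} (hW : ∀ c ∈ W, c ∉ box d m) {χ : BondConfig (Site d)} (hχE : χ ⊆ (zdGraph d).edgeSet)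
    (hgood : χ ∉ regionBadEvent Λ m) {η : Finset (Sym2 (Site d))} (hη : η ⊆ edgesIn (zdGraph d) Λ)
    {u v : Site d} (hu : u ∈ Λ) (hv : v ∈ Λ) :
    (openGraph ((↑η : Set (Sym2 (Site d))) ∪ (χ \ ↑(edgesIn (zdGraph d) Λ))) ⊔ wired W).Reachable u v ↔
      (openGraph ((↑η : Set (Sym2 (Site d))) ∪ ((χ ∩ ↑((box d m).sym2)) \ ↑(edgesIn (zdGraph d) Λ)))).Reachable
        u v := by
  have hζE : χ \ ↑(edgesIn (zdGraph d) Λ) ⊆ (zdGraph d).edgeSet := Set.sdiff_subset.trans hχE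
  rw [reachable_sup_wired_iff_mem_openConnVia hΛm hW hζE (forall_openConnVia_of_not_mem_regionBadEvent hgood)
    (Finset.coe_subset.2 hη) hu hv]
  exact union_sdiff_mem_openConnVia_iff_reachable_inter_sym2 hΛm χ hη u v

/-- **Off `D_m(Λ)` the induced connections are read inside `Λ_m`** (infinite configuration): for a lattice
configuration `χ ∉ D_m(Λ)`, `Λ ⊆ Λ_m`, every inside pattern `η ⊆ E_Λ` and `u, v ∈ Λ`:
`u ↔ v` in `η ∪ (χ ∖ E_Λ)` iff `u ↔ v` in `η ∪ ((χ ∩ Λ_m²) ∖ E_Λ)`. [cite: Grimmett2006, Lemma (4.39)] -/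
theorem reachable_union_sdiff_iff_inter_sym2 {Λ : Finset (Site d)} {m : ℕ} (hΛm : Λ ⊆ box d m)
    {χ : BondConfig (Site d)} (hχE : χ ⊆ (zdGraph d).edgeSet) (hgood : χ ∉ regionBadEvent Λ m)
    {η : Finset (Sym2 (Site d))} (hη : η ⊆ edgesIn (zdGraph d) Λ) {u v : Site d} (hu : u ∈ Λ) (hv : v ∈ Λ) :
    (openGraph ((↑η : Set (Sym2 (Site d))) ∪ (χ \ ↑(edgesIn (zdGraph d) Λ)))).Reachable u v ↔
      (openGraph ((↑η : Set (Sym2 (Site d))) ∪ ((χ ∩ ↑((box d m).sym2)) \ ↑(edgesIn (zdGraph d) Λ)))).Reachable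
        u v := by
  have key := reachable_sup_wired_union_sdiff_iff_inter_sym2 hΛm (W := ∅)
    (fun c hc => (Set.notMem_empty c hc).elim) hχE hgood hη hu hv
  rwa [wired_empty, sup_bot_eq] at key

/-- **Off `D_m(Λ)` the specification kernel is local**: for a lattice configuration `ξ ∉ D_m(Λ)` (`Λ ⊆ Λ_m`),
`φ^ξ_{Λ,p,q} = φ^{ξ ∩ Λ_m²}_{Λ,p,q}` on inside patterns. [cite: Grimmett2006, Lemma (4.39) with (4.12)–(4.13)] -/
theorem rcCondProb_eq_inter_sym2_of_not_mem_regionBadEvent {p q : ℝ} {Λ : Finset (Site d)} {m : ℕ}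
    (hΛm : Λ ⊆ box d m) {ξ : BondConfig (Site d)} (hξE : ξ ⊆ (zdGraph d).edgeSet)
    (hgood : ξ ∉ regionBadEvent Λ m) {η : Finset (Sym2 (Site d))} (hη : η ⊆ edgesIn (zdGraph d) Λ) :
    rcCondProb p q Λ ξ η = rcCondProb p q Λ (ξ ∩ ↑((box d m).sym2)) η :=
  rcCondProb_congr_of_forall_reachable_iff
    (fun _ hη' _ hu _ hv => reachable_union_sdiff_iff_inter_sym2 hΛm hξE hgood hη' hu hv) hη

end Deterministic

/-! ### Transport of wired reachability through the lift `liftEdges (box d n)` -/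

section Transport

/-- **Wired reachability lifts**: in the box `Λ_n` with wired set `B`, `⟨x⟩ ↔ ⟨y⟩` through `⟨ω₀⟩ ∨ K_B` iff,
on `ℤ^d`, `x ↔ y` through the lifted configuration and the wiring of the image of `B`.
[cite: Grimmett2006, §4.2 (configurations on E_Λ)] -/
theorem reachable_sup_wired_liftEdges_iff {n : ℕ} (ω₀ : BondConfig ↥(box d n)) (B : Set ↥(box d n))
    {x y : Site d} (hx : x ∈ box d n) (hy : y ∈ box d n) :
    (openGraph ω₀ ⊔ wired B).Reachable ⟨x, hx⟩ ⟨y, hy⟩ ↔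
      (openGraph (liftEdges (box d n) ω₀) ⊔ wired (Subtype.val '' B)).Reachable x y := by
  classical
  set G₁ := openGraph ω₀ ⊔ wired B with hG₁
  set G₂ := openGraph (liftEdges (box d n) ω₀) ⊔ wired (Subtype.val '' B) with hG₂
  -- the inclusion is a graph homomorphism
  have hadj : ∀ a b : ↥(box d n), G₁.Adj a b → G₂.Adj a b := by
    intro a b h
    rw [hG₁, SimpleGraph.sup_adj, openGraph_adj, wired_adj] at h
    rw [hG₂, SimpleGraph.sup_adj, openGraph_adj, wired_adj]
    rcases h with ⟨hab, hne⟩ | ⟨hne, ha, hb⟩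
    · refine Or.inl ⟨?_, fun h => hne (Subtype.ext h)⟩
      have : s((a : Site d), (b : Site d)) = Sym2.map Subtype.val s(a, b) := by rw [Sym2.map_mk]
      rw [this]
      exact ⟨_, hab, rfl⟩
    · exact Or.inr ⟨fun h => hne (Subtype.ext h), ⟨a, ha, rfl⟩, ⟨b, hb, rfl⟩⟩
  let φ : G₁ →g G₂ := ⟨Subtype.val, fun {a b} h => hadj a b h⟩
  refine ⟨fun h => h.map φ, fun h => ?_⟩
  -- conversely, a walk on `ℤ^d` through lifted edges and wired images stays in `Λ_n` and lifts
  suffices key : ∀ (a b : Site d) (w : G₂.Walk a b) (ha : a ∈ box d n),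
      ∃ hb : b ∈ box d n, G₁.Reachable ⟨a, ha⟩ ⟨b, hb⟩ by
    obtain ⟨hb, hr⟩ := key x y h.some hx
    exact hr
  intro a b w
  induction w with
  | nil => exact fun ha => ⟨ha, SimpleGraph.Reachable.refl _⟩
  | @cons a c b hac w ih =>
    intro ha
    rw [hG₂, SimpleGraph.sup_adj, openGraph_adj, wired_adj] at hac
    -- the step `a ~ c` comes from the box
    have hstep : ∃ hc : c ∈ box d n, G₁.Adj ⟨a, ha⟩ ⟨c, hc⟩ := by
      rcases hac with ⟨⟨e', he', hee'⟩, hne⟩ | ⟨hne, ⟨a', ha', haa'⟩, ⟨c', hc', hcc'⟩⟩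
      · induction e' using Sym2.ind with
        | h a₁ c₁ =>
          rw [Sym2.map_mk, Sym2.eq_iff] at hee'
          rcases hee' with ⟨h1, h2⟩ | ⟨h1, h2⟩
          · subst h1; subst h2
            refine ⟨c₁.2, ?_⟩
            rw [hG₁, SimpleGraph.sup_adj, openGraph_adj]
            have : (⟨(a₁ : Site d), ha⟩ : ↥(box d n)) = a₁ := Subtype.ext rfl
            rw [this]
            exact Or.inl ⟨he', fun h => hne (congrArg Subtype.val h)⟩
          · subst h1; subst h2
            refine ⟨a₁.2, ?_⟩
            rw [hG₁, SimpleGraph.sup_adj, openGraph_adj]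
            have : (⟨(c₁ : Site d), ha⟩ : ↥(box d n)) = c₁ := Subtype.ext rfl
            rw [this, Sym2.eq_swap]
            exact Or.inl ⟨he', fun h => hne (congrArg Subtype.val h)⟩
      · subst haa'; subst hcc'
        refine ⟨c'.2, ?_⟩
        rw [hG₁, SimpleGraph.sup_adj, wired_adj]
        have h1 : (⟨(a' : Site d), ha⟩ : ↥(box d n)) = a' := Subtype.ext rfl
        have h2 : (⟨(c' : Site d), c'.2⟩ : ↥(box d n)) = c' := Subtype.ext rfl
        rw [h1, h2]
        exact Or.inr ⟨fun h => hne (congrArg Subtype.val h), ha', hc'⟩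
    obtain ⟨hc, hG⟩ := hstep
    obtain ⟨hb, hr⟩ := ih hc
    exact ⟨hb, hG.reachable.trans hr⟩

/-- The image of the box boundary condition lies outside every smaller box. [cite: Grimmett2006, §4.2 (4.11)–(4.12)] -/
theorem forall_image_boxBC_not_mem_box {b : Bool} {n m : ℕ} (hmn : m + 1 ≤ n) :
    ∀ c ∈ Subtype.val '' boxBC d b n, c ∉ box d m := by
  rintro _ ⟨c, hc, rfl⟩
  exact not_mem_box_of_mem_boxBC hmn hc

end Transport

end Summit.CriticalPhenomena.PercolationContinuityZ3.Theorems.FK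

end
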